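import Summits.MatrixMultiplication.MatrixMultiplication.Theorems.SaturationLadderTowerQuarter
import Summits.MatrixMultiplication.OmegaCensus.RectangularExponentRealScalarExtension
import HarnessLib

/-!
# Saturation ladder — Kernel XXII: closedness of thin tightness, attained frontier and length, tower limits

Route `SaturationLadder` (deciding crux `h₁ = SubexpSaturation`; thin currency `ω(1,t,r) ≤ 1 + r`, equivalently
`= 1 + r` since `1 + r ≤ ω(1,t,r)` always).  Critic's offer K51-L, with a correction of the record: the
semicontinuity of `t ↦ ω_K(1,t,r)` needed for limit points IS in the tree — `OmegaCensus.continuous_omegaRect`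
(joint 3-Lipschitz continuity of `(a,b,c) ↦ ω_K(a,b,c)`, every field `K`).  From it:

§1 **Closedness.**  `{t | ω_K(1,t,r) ≤ 1+r}`, `{r | ω_K(1,t,r) ≤ 1+r}` and the joint thin region
   `{(t,r) | ω_K(1,t,r) ≤ 1+r}` are closed; thin tightness / exactness passes to limits of sequences
   (`thinTight_of_tendsto`, `thinExact_of_tendsto`).
§2 **Staircase structure, extremes attained.**  The thin region is a down-set in `t` and an up-set in `r`;
   for `r ≥ 0` the THIN FRONTIER `τ_K(r) := sSup {t | ω_K(1,t,r) ≤ 1+r}` is attained, `0 ≤ τ_K(r) ≤ 1`, and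
   `ω_K(1,t,r) ≤ 1+r ↔ t ≤ τ_K(r)` (`thinFrontier_attained`); dually the SATURATION LENGTH
   `σ_K(t) := sInf {r ≥ 1 | ω_K(1,t,r) ≤ 1+r}` is attained and the tight lengths `≥ 1` are exactly `[σ_K(t), ∞)`
   (`satLength_attained`).  So the informal `r(t) = min{…}` of the route header is a genuine minimum, and `h₁` reads
   `σ_ℂ(t) ≤ exp(c/(1-t))` eventually, for every `c > 0`.
§3 **Tower limits.**  Every Schönhage-pair squaring tower (Kernels XVIII, XXI: `t₀ < t₁ < … < T(e,l) < 1/4`, all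
   stages exact at `ρ = log l/log e`) CONVERGES, `t_j ↑ t_∞(e,l)`, and the limit is itself an exact thin point
   `ω_K(1, t_∞, ρ) = 1 + ρ` over every field, with `t_j < t_∞ ≤ T(e,l) < 1/4` (`schoenhagePairTowerLimit`);
   symmetric pairs give limit plateau points `ω_K(1, t_∞(n), 1) = 2`, `t_∞(n) < α_Copp` (`schoenhageSquareTowerLimit`);
   the `(2,5)` tower gives an exact thin point with `1/5 < t_∞ < 1/4` at `ρ = log₂ 5`; and the thin frontier satisfies
   `τ_K(r) > t₀(e,l)` for every `r ≥ log l/log e` (`thinFrontier_lower`) — unconditional, every characteristic.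

Census reading: the squaring-tower method is closed under limits and still capped below `1/4` (Kernel XXI), two
rungs short of what `h₁` needs (`t → 1`); its honest output is the dense staircase of exact points
`(t_∞(e,l), log l/log e)`, numerically topped by `t_∞(2,4) = 0.20842` at `ρ = 2`.

Def-free (frontier/length written inline as `sSup`/`sInf`), sorry-free.
-/

set_option linter.dupNamespace false

noncomputable section

open scoped BigOperators Topology
open Filter

namespace Summit.MatrixMultiplication.MatrixMultiplication.Theorems.SaturationLadderTowerLimit

open Literature.Computability.AlgebraicComplexity
open Summit.MatrixMultiplication.OmegaCensus
open Summit.MatrixMultiplication.MatrixMultiplication.Theorems.SaturationLadderTowerCeiling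
open Summit.MatrixMultiplication.MatrixMultiplication.Theorems.SaturationLadderTowerSchoenhage
open Summit.MatrixMultiplication.MatrixMultiplication.Theorems.SaturationLadderTowerQuarter

variable (K : Type) [Field K]

/-! ## §1 Closedness of thin tightness -/

/-- The middle slice `t ↦ ω_K(1,t,r)` is continuous. -/
theorem continuous_omegaRect_mid (r : ℝ) : Continuous fun t : ℝ => omegaRect K 1 t r := by
  have hg : Continuous fun t : ℝ => ((1 : ℝ), t, r) := by fun_prop
  have h := (continuous_omegaRect K).comp hg
  rwa [Function.comp_def] at h

/-- The length slice `r ↦ ω_K(1,t,r)` is continuous. -/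
theorem continuous_omegaRect_len (t : ℝ) : Continuous fun r : ℝ => omegaRect K 1 t r := by
  have hg : Continuous fun r : ℝ => ((1 : ℝ), t, r) := by fun_prop
  have h := (continuous_omegaRect K).comp hg
  rwa [Function.comp_def] at h

/-- **The thin-tight set in the middle exponent is closed.** -/
theorem isClosed_thinTight_mid (r : ℝ) : IsClosed {t : ℝ | omegaRect K 1 t r ≤ 1 + r} :=
  isClosed_le (continuous_omegaRect_mid K r) continuous_const

/-- **The thin-tight set in the length is closed.** -/
theorem isClosed_thinTight_len (t : ℝ) : IsClosed {r : ℝ | omegaRect K 1 t r ≤ 1 + r} :=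
  isClosed_le (continuous_omegaRect_len K t) (continuous_const.add continuous_id)

/-- **The thin region `{(t,r) | ω_K(1,t,r) ≤ 1+r}` is closed in the plane.** -/
theorem isClosed_thinTight : IsClosed {p : ℝ × ℝ | omegaRect K 1 p.1 p.2 ≤ 1 + p.2} := by
  have hg : Continuous fun p : ℝ × ℝ => ((1 : ℝ), p.1, p.2) := by fun_prop
  have h := (continuous_omegaRect K).comp hg
  rw [Function.comp_def] at h
  have h2 : Continuous fun p : ℝ × ℝ => 1 + p.2 := by fun_prop
  exact isClosed_le h h2

/-- Thin tightness passes to limits in `t`. -/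
theorem thinTight_of_tendsto {t : ℕ → ℝ} {t' r : ℝ} (h : Tendsto t atTop (𝓝 t'))
    (ht : ∀ j, omegaRect K 1 (t j) r ≤ 1 + r) : omegaRect K 1 t' r ≤ 1 + r :=
  (isClosed_thinTight_mid K r).mem_of_tendsto h (Eventually.of_forall ht)

/-- **Exact thin points are closed under limits**: `ω_K(1,t_j,r) = 1+r`, `t_j → t'` ⇒ `ω_K(1,t',r) = 1+r`. -/
theorem thinExact_of_tendsto {t : ℕ → ℝ} {t' r : ℝ} (h : Tendsto t atTop (𝓝 t'))
    (ht : ∀ j, omegaRect K 1 (t j) r = 1 + r) : omegaRect K 1 t' r = 1 + r :=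
  le_antisymm (thinTight_of_tendsto K h fun j => (ht j).le) (add_le_omegaRect₁₃ K 1 t' r)

/-- Joint version: `(t_j, r_j) → (t', r')` with all `(t_j, r_j)` thin-tight ⇒ `(t', r')` thin-tight. -/
theorem thinTight_of_tendsto₂ {t r : ℕ → ℝ} {t' r' : ℝ} (ht : Tendsto t atTop (𝓝 t'))
    (hr : Tendsto r atTop (𝓝 r')) (h : ∀ j, omegaRect K 1 (t j) (r j) ≤ 1 + r j) :
    omegaRect K 1 t' r' ≤ 1 + r' := by
  have hp : Tendsto (fun j => (t j, r j)) atTop (𝓝 (t', r')) := ht.prodMk_nhds hr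
  have hev : ∀ᶠ j in atTop, (t j, r j) ∈ {p : ℝ × ℝ | omegaRect K 1 p.1 p.2 ≤ 1 + p.2} :=
    Eventually.of_forall fun j => by
      simp only [Set.mem_setOf_eq]
      exact h j
  have hmem : (t', r') ∈ {p : ℝ × ℝ | omegaRect K 1 p.1 p.2 ≤ 1 + p.2} :=
    (isClosed_thinTight K).mem_of_tendsto hp hev
  simpa only [Set.mem_setOf_eq] using hmem

/-! ## §2 Staircase structure; frontier and saturation length are attained -/

/-- Down-set in `t`. -/
theorem thinTight_of_le {t t' r : ℝ} (h : t ≤ t') (ht' : omegaRect K 1 t' r ≤ 1 + r) :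
    omegaRect K 1 t r ≤ 1 + r :=
  (omegaRect_mono₂ K h).trans ht'

/-- Up-set in `r` (`ω(1,t,r') ≤ ω(1,t,r) + (r' - r)`). -/
theorem thinTight_of_len_le {t r r' : ℝ} (h : r ≤ r') (hr : omegaRect K 1 t r ≤ 1 + r) :
    omegaRect K 1 t r' ≤ 1 + r' := by
  have := omegaRect_le_add₃ K (a := 1) (b := t) h
  linarith

/-- A thin-tight middle exponent is `≤ 1` (`t + r ≤ ω(1,t,r)`). -/
theorem le_one_of_thinTight {t r : ℝ} (h : omegaRect K 1 t r ≤ 1 + r) : t ≤ 1 := by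
  have := add_le_omegaRect₂₃ K 1 t r
  linarith

/-- `t = 0` is thin-tight for every `r ≥ 0`. -/
theorem thinTight_zero {r : ℝ} (hr : 0 ≤ r) : omegaRect K 1 0 r ≤ 1 + r := by
  have h := omegaRect_le_max K (rectAdmissibleExponents_bddBelow K 1 0 r)
  rw [max_eq_left zero_le_one, max_self, max_eq_left hr] at h
  linarith

/-- **THE THIN FRONTIER IS ATTAINED.**  For `r ≥ 0`, `τ_K(r) := sSup {t | ω_K(1,t,r) ≤ 1+r}` is thin-tight,
`0 ≤ τ_K(r) ≤ 1`, and the thin-tight middle exponents are exactly `(-∞, τ_K(r)]`. -/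
theorem thinFrontier_attained {r : ℝ} (hr : 0 ≤ r) :
    omegaRect K 1 (sSup {t : ℝ | omegaRect K 1 t r ≤ 1 + r}) r ≤ 1 + r ∧
    0 ≤ sSup {t : ℝ | omegaRect K 1 t r ≤ 1 + r} ∧
    sSup {t : ℝ | omegaRect K 1 t r ≤ 1 + r} ≤ 1 ∧
    ∀ t, omegaRect K 1 t r ≤ 1 + r ↔ t ≤ sSup {t : ℝ | omegaRect K 1 t r ≤ 1 + r} := by
  have hne : ({t : ℝ | omegaRect K 1 t r ≤ 1 + r}).Nonempty := ⟨0, thinTight_zero K hr⟩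
  have hbdd : BddAbove {t : ℝ | omegaRect K 1 t r ≤ 1 + r} := ⟨1, fun t ht => le_one_of_thinTight K ht⟩
  have hmem : sSup {t : ℝ | omegaRect K 1 t r ≤ 1 + r} ∈ {t : ℝ | omegaRect K 1 t r ≤ 1 + r} :=
    (isClosed_thinTight_mid K r).csSup_mem hne hbdd
  refine ⟨hmem, le_csSup hbdd (thinTight_zero K hr), csSup_le hne fun t ht => le_one_of_thinTight K ht,
    fun t => ⟨fun ht => le_csSup hbdd ht, fun ht => thinTight_of_le K ht hmem⟩⟩

/-- **THE SATURATION LENGTH IS ATTAINED.**  If some `r ≥ 1` is thin-tight at `t`, then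
`σ_K(t) := sInf {r | 1 ≤ r ∧ ω_K(1,t,r) ≤ 1+r}` satisfies `1 ≤ σ_K(t)`, is thin-tight, and for `r ≥ 1`:
`ω_K(1,t,r) ≤ 1 + r ↔ σ_K(t) ≤ r` — the `r(t) = min{…}` of the route header is a minimum. -/
theorem satLength_attained {t : ℝ} (h : ∃ r, 1 ≤ r ∧ omegaRect K 1 t r ≤ 1 + r) :
    1 ≤ sInf {r : ℝ | 1 ≤ r ∧ omegaRect K 1 t r ≤ 1 + r} ∧
    omegaRect K 1 t (sInf {r : ℝ | 1 ≤ r ∧ omegaRect K 1 t r ≤ 1 + r}) ≤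
      1 + sInf {r : ℝ | 1 ≤ r ∧ omegaRect K 1 t r ≤ 1 + r} ∧
    ∀ r, 1 ≤ r →
      (omegaRect K 1 t r ≤ 1 + r ↔ sInf {r : ℝ | 1 ≤ r ∧ omegaRect K 1 t r ≤ 1 + r} ≤ r) := by
  have hne : ({r : ℝ | 1 ≤ r ∧ omegaRect K 1 t r ≤ 1 + r}).Nonempty := h
  have hbdd : BddBelow {r : ℝ | 1 ≤ r ∧ omegaRect K 1 t r ≤ 1 + r} := ⟨1, fun r hr => hr.1⟩
  have hclosed : IsClosed {r : ℝ | 1 ≤ r ∧ omegaRect K 1 t r ≤ 1 + r} := by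
    rw [Set.setOf_and]
    exact isClosed_Ici.inter (isClosed_thinTight_len K t)
  have hmem := hclosed.csInf_mem hne hbdd
  exact ⟨hmem.1, hmem.2, fun r hr =>
    ⟨fun hrt => csInf_le hbdd ⟨hr, hrt⟩, fun hσ => thinTight_of_len_le K hσ hmem.2⟩⟩

/-- The joint reading: the thin region is the closed staircase `{(t,r) | t ≤ τ_K(r)}` (`r ≥ 0`), and
`τ_K` is monotone: `r ≤ r' ⇒ τ_K(r) ≤ τ_K(r')`. -/
theorem thinFrontier_mono {r r' : ℝ} (hr : 0 ≤ r) (h : r ≤ r') :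
    sSup {t : ℝ | omegaRect K 1 t r ≤ 1 + r} ≤ sSup {t : ℝ | omegaRect K 1 t r' ≤ 1 + r'} := by
  obtain ⟨hmem, -, -, -⟩ := thinFrontier_attained K hr
  obtain ⟨-, -, -, hiff⟩ := thinFrontier_attained K (hr.trans h)
  exact (hiff _).1 (thinTight_of_len_le K h hmem)

/-! ## §3 Limits of the squaring towers -/

/-- A sequence with `t_j < t_{j+1} ≤ T` converges; the limit dominates every term strictly and is `≤ T`. -/
theorem exists_tendsto_of_lt_succ {t : ℕ → ℝ} {T : ℝ} (hstep : ∀ j, t j < t (j + 1)) (hT : ∀ j, t j ≤ T) :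
    ∃ t' : ℝ, Tendsto t atTop (𝓝 t') ∧ (∀ j, t j < t') ∧ t' ≤ T := by
  have hmono : StrictMono t := strictMono_nat_of_lt_succ hstep
  have hbdd : BddAbove (Set.range t) := ⟨T, by rintro _ ⟨j, rfl⟩; exact hT j⟩
  exact ⟨⨆ j, t j, tendsto_atTop_ciSup hmono.monotone hbdd,
    fun j => (hstep j).trans_le (le_ciSup hbdd (j + 1)), ciSup_le hT⟩

/-- **EVERY SCHÖNHAGE-PAIR TOWER CONVERGES TO AN EXACT THIN POINT BELOW `1/4`.**  For `e, l ≥ 2` the squaring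
tower on `⟨1,l-1,1⟩ ⊕ ⟨e,1,l⟩` has `t₀ < t₁ < … ↑ t_∞`, all stages AND the limit exact at `ρ = log l/log e` over
every field, `t_j < t_∞ ≤ T(e,l) < 1/4`. -/
theorem schoenhagePairTowerLimit (e l : ℕ) (he : 2 ≤ e) (hl : 2 ≤ l) :
    ∃ (t : ℕ → ℝ) (t' : ℝ),
      t 0 = Real.log (((e - 1) * (l - 1) : ℕ) : ℝ) / ((e : ℝ) * l * Real.log e) ∧
      (∀ j, t j < t (j + 1)) ∧ Tendsto t atTop (𝓝 t') ∧ (∀ j, t j < t') ∧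
      t' ≤ Real.log (((e - 1) * (l - 1) : ℕ) : ℝ) / ((e : ℝ) * l * Real.log e) +
        ((e : ℝ) * l + 1) ^ 2 / (((e : ℝ) * l + 1) ^ 2 - 1) *
          (Real.log ((e : ℝ) * l + 1) / (((e : ℝ) * l + 1) * ((e : ℝ) * l * Real.log e))) ∧
      t' < 1 / 4 ∧
      (∀ j, omegaRect K 1 (t j) (Real.log l / Real.log e) = 1 + Real.log l / Real.log e) ∧
      omegaRect K 1 t' (Real.log l / Real.log e) = 1 + Real.log l / Real.log e := by
  obtain ⟨t, r, A, ht0, -, -, -, -, hstep, hpt, -, hceil⟩ := schoenhagePairTower K e l he hl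
  obtain ⟨t', hlim, hlt, hle⟩ := exists_tendsto_of_lt_succ hstep fun j => (hceil j).le
  exact ⟨t, t', ht0, hstep, hlim, hlt, hle, hle.trans_lt (pairCeiling_lt_quarter e l he hl), hpt,
    thinExact_of_tendsto K hlim hpt⟩

/-- **Symmetric pairs: limit plateau points.**  For `n ≥ 2` the squaring tower on `⟨1,n-1,1⟩ ⊕ ⟨n,1,n⟩`
converges to `t_∞(n)` with `ω_K(1, t_∞(n), 1) = 2` over every field, `t_j < t_∞(n) < α_Copp` and `< 1/4`. -/
theorem schoenhageSquareTowerLimit (n : ℕ) (hn : 2 ≤ n) :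
    ∃ (t : ℕ → ℝ) (t' : ℝ),
      t 0 = Real.log (((n - 1) * (n - 1) : ℕ) : ℝ) / ((n : ℝ) * n * Real.log n) ∧
      (∀ j, t j < t (j + 1)) ∧ Tendsto t atTop (𝓝 t') ∧ (∀ j, t j < t') ∧
      t' < coppersmithExponent ∧ t' < 1 / 4 ∧
      (∀ j, omegaRect K 1 (t j) 1 = 2) ∧ omegaRect K 1 t' 1 = 2 := by
  obtain ⟨t, r, A, ht0, -, -, -, -, hstep, hpt, -, hceil⟩ := schoenhagePairTower K n n hn hn
  obtain ⟨t', hlim, hlt, hle⟩ := exists_tendsto_of_lt_succ hstep fun j => (hceil j).le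
  have hlog : Real.log (n : ℝ) ≠ 0 := (Real.log_pos (by exact_mod_cast hn : (1 : ℝ) < n)).ne'
  have hlim' := thinExact_of_tendsto K hlim hpt
  rw [div_self hlog] at hlim'
  have hpt' : ∀ j, omegaRect K 1 (t j) 1 = 2 := fun j => by
    have h := hpt j
    rw [div_self hlog] at h
    rw [h]
    norm_num
  refine ⟨t, t', ht0, hstep, hlim, hlt, hle.trans_lt (squareCeiling_lt_coppersmith n hn),
    hle.trans_lt (pairCeiling_lt_quarter n n hn hn), hpt', ?_⟩
  rw [hlim']
  norm_num

/-- **The `(2,5)` limit point**: an exact thin point `ω_K(1, t_∞, log 5/log 2) = 1 + log 5/log 2` with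
`1/5 < t_∞ < 1/4`, over every field (numerically `t_∞ = 0.2053477`). -/
theorem schoenhageTowerLimit_two_five :
    ∃ t' : ℝ, 1 / 5 < t' ∧ t' < 1 / 4 ∧
      omegaRect K 1 t' (Real.log 5 / Real.log 2) = 1 + Real.log 5 / Real.log 2 := by
  obtain ⟨t, t', ht0, -, -, hlt, -, hq, -, hexact⟩ := schoenhagePairTowerLimit K 2 5 (by norm_num) (by norm_num)
  have log_four : Real.log 4 = 2 * Real.log 2 := by
    rw [show (4 : ℝ) = 2 ^ 2 by norm_num, Real.log_pow]; push_cast; ring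
  have h2 : Real.log 2 ≠ 0 := (Real.log_pos one_lt_two).ne'
  have h0 : t 0 = 1 / 5 := by
    rw [ht0]
    norm_num
    rw [log_four]
    field_simp
    ring
  refine ⟨t', ?_, by simpa using hq, by simpa using hexact⟩
  rw [← h0]
  exact hlt 0

/-- **Unconditional lower bounds on the thin frontier, every characteristic.**  For `e, l ≥ 2` and every
`r ≥ log l / log e`: the base abscissa `t₀(e,l) = log((e-1)(l-1))/(el log e)` lies STRICTLY below the frontier,
`t₀(e,l) < τ_K(r) = sSup {t | ω_K(1,t,r) ≤ 1+r}` (the tower limit `t_∞(e,l)` is tight at `r`). -/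
theorem thinFrontier_lower (e l : ℕ) (he : 2 ≤ e) (hl : 2 ≤ l) {r : ℝ} (hr : Real.log l / Real.log e ≤ r) :
    Real.log (((e - 1) * (l - 1) : ℕ) : ℝ) / ((e : ℝ) * l * Real.log e) <
      sSup {t : ℝ | omegaRect K 1 t r ≤ 1 + r} := by
  obtain ⟨t, t', ht0, -, -, hlt, -, -, -, hexact⟩ := schoenhagePairTowerLimit K e l he hl
  have hρ : 0 ≤ Real.log l / Real.log e :=
    div_nonneg (Real.log_nonneg (by exact_mod_cast (by omega : 1 ≤ l)))
      (Real.log_nonneg (by exact_mod_cast (by omega : 1 ≤ e)))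
  have htight : omegaRect K 1 t' r ≤ 1 + r := thinTight_of_len_le K hr hexact.le
  obtain ⟨-, -, -, hiff⟩ := thinFrontier_attained K (hρ.trans hr)
  have := (hiff t').1 htight
  rw [← ht0]
  exact (hlt 0).trans_le this

end Summit.MatrixMultiplication.MatrixMultiplication.Theorems.SaturationLadderTowerLimit

end
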